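import Summits.AtomisticToContinuum.Crystallization.Theorems.ChartedZeroExcessLayeredLatticeLiouvilleXY

/-!
# Charted zero-excess layered lattice Liouville — part YB «SingleTolerance»: (R_Wᵇ) from [Tᵇ] ∧ [W_Ψᵇ] ALONE; the single-tolerance
# leaf [W_Ψᵇ₁]; the columns `_16XH21B`, `_16XH21B₁` (CRITIC-LEDGER row 1160, critic kernel finding re-typed by lens-2)

Docket `stmt-AtomisticToContinuum-26636` (N = `ChartedPlanarOrder.ChartedZeroExcessLayered`), cell decomp-a2c, seat lens-2 g60.

THE FINDING (critic g24, row 1160; typed here).  [W_Ψᵇ] `CoherentWindowPsiBPG` (part UN) is a rate-free sup-norm statement: at ANY tolerance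
`(ϑ₁, ω₁)` every `4`-star of the tame window is `(ϑ₁, ω₁)`-coherent as measured by `Ψ`.  A coherent star has bond distortion
`dist (p − x) (Ψ p − Ψ x) ≤ 4·ω₁ + ϑ₁` (YB.1, triangle inequality + part TR `dist_map_le_tilt`), so at ONE coarse tolerance with `4·ω₁ + ϑ₁ < ϑ₀ =
tameRadius = 1/20` — default `(1/100, 1/200)`: `4/200 + 1/100 = 3/100` — the window has NO `ϑ₀`-wild bond at all: `wildMass tameRadius (win R) Ψ = 0` (part
XY `wildMass_eq_zero_of_lt`), which is (R_Wᵇ) `WildFractionBPG` with `Ψ' := Ψ`, `Cg' := Cg` (YB.3).  The sub-window budget [SBᵇ] and with it the SB-glue,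
(RC) `EquilChartStrainP`, (I4ˢ) `TailFluxBSP` (parts XM–XW, XZ, YA) are NOT needed for (R_Wᵇ): they LEAVE the critical path of the docket (proved-stronger
side results).

* YB.2 the SINGLE-TOLERANCE LEAF [W_Ψᵇ₁] `CoherentWindowPsiBPG₁ ϑ₁ ω₁ ϑ aHi Λ θ s` := [W_Ψᵇ]'s body at the fixed pair `(ϑ₁, ω₁)` (a projection of [W_Ψᵇ]:
  `coherentWindowPsiBPG₁_of`; a WEAKENING of the residual, not a re-typing), monotone in the pair.
* YB.3 `wildFractionBPG_of_tame_coherent₁` under the side condition `4·ω₁ + ϑ₁ < tameRadius` (any admissible pair: default `(1/100, 1/200)`; the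
  weakest-misfit pair `(1/24, 1/500)` also qualifies), `wildFractionBPG_of_tame_coherent` ([W_Ψᵇ] at the default pair), and the dressed-core forms via part
  UK `tameWindowBPG_of_dressedCore_of_bare` ([Tᵇ] ⟸ [I_D] ∧ [T_bᵇ]).
* YB.4 ★★★ COLUMN OF RECORD `gap_and_pert_1_50_of_certs_16XH21B`: part UI `_16XH18B_tol` (ν := 1/2000, (Υb) := `untwistBookkeepingP_one`) with (R_Wᵇ) cut by
  [I_D] ∧ [T_bᵇ] ∧ [W_Ψᵇ] — part XY's `_16XH20B` with `hglueS`, `hRC`, `h4` DELETED; and `_16XH21B₁` with [W_Ψᵇ] replaced by the single-tolerance leaf at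
  `(1/100, 1/200)`.  RESIDUAL DOCKET OF RECORD := the twenty generic leaves of `_16XH18B_tol` + the trio {[I_D] `DressedCorePG`, [T_bᵇ] `BareTameWindowBPG`,
  [W_Ψᵇ₁] `CoherentWindowPsiBPG₁ (1/100) (1/200)`} + the crystal import `PeriodicBulkGapDoor 2`.
-/

noncomputable section

open scoped BigOperators
open MeasureTheory Set Metric Filter Topology
open Summit.AtomisticToContinuum.Crystallization.Theorems.ChartedPlanarOrderRigidityDoor (E3 atomsIn VisibleGap PertRegime)
open Summit.AtomisticToContinuum.Crystallization.Theorems.ChartedPlanarOrderDensityDichotomy (μS IsSep nK nK_nonneg)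
open Summit.AtomisticToContinuum.Crystallization.Theorems.ChartedPlanarOrderCleanScaleP (IsCleanP IsDoorSetP)
open Summit.AtomisticToContinuum.Crystallization.Theorems.ChartedPlanarOrderMesoCut (LayeredHom EnvClose)
open Summit.AtomisticToContinuum.Crystallization.Theorems.ChartedPlanarOrderDoorLayered (atomsIn_subset sq_le_finsum_mem PeriodicBulkGapDoor)
open Summit.AtomisticToContinuum.Crystallization.Theorems.ChartedPlanarOrderDoorLayeredOsc (IsTwoShellAffineGood)

namespace Summit.AtomisticToContinuum.Crystallization.Theorems.ChartedZeroExcessLayeredLatticeLiouville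

/-! ### YB.1  A Ψ-coherent star has small bond distortion -/

/-- ★ **a `(ϑ₁, ω₁)`-coherent star (measured by `Ψ`) has every `4`-bond distorted by at most `4·ω₁ + ϑ₁`**: `dist (p − x) (Ψ p − Ψ x) ≤
dist (p − x) (U (p − x)) + dist (U (p − x)) (Ψ p − Ψ x) ≤ tilt U·‖p − x‖ + ϑ₁` (part TR `dist_map_le_tilt`). [critic g24 row 1160; this file, g60] -/
theorem dist_bond_le_of_isCoherentBy {ϑ₁ ω₁ : ℝ} {S K : Set E3} {Ψ : E3 → E3} (h : IsCoherentBy ϑ₁ ω₁ S Ψ K)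
    {x p : E3} (hx : x ∈ K) (hp : p ∈ S) (hpx : dist p x ≤ 4) : dist (p - x) (Ψ p - Ψ x) ≤ 4 * ω₁ + ϑ₁ := by
  obtain ⟨U, -, hU, hb⟩ := h x hx
  have h1 : dist (p - x) (U (p - x)) ≤ tilt U * ‖p - x‖ := dist_map_le_tilt U (p - x)
  have h2 : ‖p - x‖ ≤ 4 := by rwa [← dist_eq_norm]
  have h3 : tilt U * ‖p - x‖ ≤ ω₁ * 4 := mul_le_mul hU h2 (norm_nonneg _) ((tilt_nonneg U).trans hU)
  calc dist (p - x) (Ψ p - Ψ x) ≤ dist (p - x) (U (p - x)) + dist (U (p - x)) (Ψ p - Ψ x) := dist_triangle _ _ _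
    _ ≤ ω₁ * 4 + ϑ₁ := add_le_add (h1.trans h3) (hb p hp hpx)
    _ = 4 * ω₁ + ϑ₁ := by ring

/-- hence: coherence on `K ⊇ Q` at a pair with `4·ω₁ + ϑ₁ < ϑ` ⇒ NO `ϑ`-wild bond inside `Q` (`wildMass ϑ Q Ψ = 0`, part XY `wildMass_eq_zero_of_lt`). [this file, g60] -/
theorem wildMass_eq_zero_of_isCoherentBy {ϑ ϑ₁ ω₁ : ℝ} {S K Q : Set E3} {Ψ : E3 → E3} (h : IsCoherentBy ϑ₁ ω₁ S Ψ K)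
    (hQK : Q ⊆ K) (hQS : Q ⊆ S) (hside : 4 * ω₁ + ϑ₁ < ϑ) : wildMass ϑ Q Ψ = 0 :=
  wildMass_eq_zero_of_lt fun _ hx _ hp hpx => (dist_bond_le_of_isCoherentBy h (hQK hx) (hQS hp) hpx).trans_lt hside

/-! ### YB.2  The single-tolerance leaf [W_Ψᵇ₁] -/

/-- ★★ **[W_Ψᵇ₁] «CoherentWindowPsiBPG₁ ϑ₁ ω₁ ϑ aHi Λ θ s» — TAME FAT NEAR-FLAT GSC DOOR WINDOWS ARE Ψ-COHERENT AT THE ONE TOLERANCE `(ϑ₁, ω₁)`**: the body of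
[W_Ψᵇ] `CoherentWindowPsiBPG` (part UN) at a FIXED pair (`ϑ₁` = bond misfit after the best rotation, `ω₁` = tilt of that rotation), all other binders verbatim
(bond-isomorphic `(Cg, η, R)`-registered `Ψ`, `K₀`-fat window, `ϑ`-tame on `win 9R`; conclusion `IsCoherentBy ϑ₁ ω₁ S Ψ (win 9R)`).  A projection of [W_Ψᵇ]
(`coherentWindowPsiBPG₁_of`), consumed by (R_Wᵇ) under the side condition `4·ω₁ + ϑ₁ < tameRadius = 1/20` at ONE pair — default `(1/100, 1/200)`; the
weakest-misfit admissible pair is about `(1/24, 1/500)`.  ε-REGULARITY-type (orientation locking `tilt ≤ ω₁` at EVERY site from the L² registration level +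
Ψ-misfit gain `1/20 → ϑ₁`) · GSC-priced · UNDECIDED · NECESSARY-type · INSTRUMENTABLE ((F1) «CoherenceScan» AT the pair: misfit and tilt columns).  Why it might
fail: a dislocation-free TWISTED TAME GRAIN of size `r ≲ (Cg·η)^{1/3}·ω₁^{−2/3}·R` rotated by `ω ≥ ω₁` (compatibility prices it at `≍ ω²r³ ≤ Cg·η·R³`, every star
stays `1/20`-tame, the tilt clause fails inside the budget) — excluded only by equilibrium + stability (elastic Liouville in the window); a bond-isomorphic `Ψ`
registered to the wrong one of two `1/4`-close environments of an aperiodic chart (up to `osc_H`).  Sources: part UN ([W_Ψᵇ]); part UD ([W]); F. John 1961;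
Friesecke–James–Müller 2002 Thm 3.1; CRITIC-LEDGER row 1160. [this file, g60] -/
def CoherentWindowPsiBPG₁ (ϑ₁ ω₁ : ℝ) (ϑ aHi Λ θ s : ℝ) : Prop :=
  ∀ δ : ℝ, 0 < δ → ∀ a : ℝ, 0 < a → ∀ Cg : ℝ, 1 ≤ Cg → ∀ K₀ : ℝ, 0 < K₀ → ∃ η₁ : ℝ, 0 < η₁ ∧ ∃ R₁ : ℝ, 0 < R₁ ∧
    ∀ S : Set E3, IsDoorSetPG aHi δ S → (∀ q ∈ S, IsTwoShellAffineGood θ S q) →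
      ∀ η : ℝ, 0 < η → η ≤ η₁ → ∀ R : ℝ, R₁ ≤ R →
        ∀ (L : E3 ≃L[ℝ] E3) (w : ℤ → E3), IsEquilChart a s Λ L w →
          ∀ Ψ : E3 → E3, IsGlobalReg Cg η R S (LayeredHom (L : E3 →L[ℝ] E3) w) Ψ → IsBondIso S Ψ →
            K₀ ≤ η * nK (atomsIn (μS S) 0 R) →
              IsTameOn ϑ S (LayeredHom (L : E3 →L[ℝ] E3) w) (atomsIn (μS S) 0 (9 * R)) →
              IsCoherentBy ϑ₁ ω₁ S Ψ (atomsIn (μS S) 0 (9 * R))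

/-- **[W_Ψᵇ] ⇒ [W_Ψᵇ₁]** at every positive pair (projection). [this file, g60] -/
theorem coherentWindowPsiBPG₁_of {ϑ₁ ω₁ ϑ aHi Λ θ s : ℝ} (h : CoherentWindowPsiBPG ϑ aHi Λ θ s) (hϑ₁ : 0 < ϑ₁) (hω₁ : 0 < ω₁) :
    CoherentWindowPsiBPG₁ ϑ₁ ω₁ ϑ aHi Λ θ s :=
  h ϑ₁ hϑ₁ ω₁ hω₁

/-- [W_Ψᵇ₁] is monotone in the pair (a finer tolerance implies a coarser one). [this file, g60] -/
theorem coherentWindowPsiBPG₁_mono {ϑ₁ ϑ₁' ω₁ ω₁' ϑ aHi Λ θ s : ℝ} (hϑ : ϑ₁ ≤ ϑ₁') (hω : ω₁ ≤ ω₁')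
    (h : CoherentWindowPsiBPG₁ ϑ₁ ω₁ ϑ aHi Λ θ s) : CoherentWindowPsiBPG₁ ϑ₁' ω₁' ϑ aHi Λ θ s := by
  intro δ hδ a ha Cg hCg K₀ hK₀
  obtain ⟨η₁, hη₁, R₁, hR₁, h1⟩ := h δ hδ a ha Cg hCg K₀ hK₀
  exact ⟨η₁, hη₁, R₁, hR₁, fun S hS hgood η hη hηle R hR L w hLw Ψ hΨ hBI hfat htame =>
    (h1 S hS hgood η hη hηle R hR L w hLw Ψ hΨ hBI hfat htame).mono hϑ hω Subset.rfl⟩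

/-! ### YB.3  (R_Wᵇ) from [Tᵇ] ∧ [W_Ψᵇ₁] under the side condition; the dressed-core forms -/

/-- ★★ **(R_Wᵇ) ⟸ [Tᵇ] ∧ [W_Ψᵇ₁] whenever `4·ω₁ + ϑ₁ < tameRadius`** (`Ψ' := Ψ`, `Cg' := Cg`, `η₁ := min`, `R₁ := max`; `win R ⊆ win 9R`): tameness on
`win 9R` from [Tᵇ] feeds [W_Ψᵇ₁], whose coherence kills every `tameRadius`-wild bond of `win R` (YB.1) — the wild mass is ZERO, in particular
`≤ εw·η·nK(win R)`. [critic g24 row 1160; this file, g60] -/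
theorem wildFractionBPG_of_tame_coherent₁ {ϑ₁ ω₁ ϑ aHi Λ θ s : ℝ} (hside : 4 * ω₁ + ϑ₁ < tameRadius)
    (hT : TameWindowBPG ϑ aHi Λ θ s) (hW : CoherentWindowPsiBPG₁ ϑ₁ ω₁ ϑ aHi Λ θ s) : WildFractionBPG aHi Λ θ s := by
  intro δ hδ a ha Cg hCg
  refine ⟨Cg, le_rfl, fun εw hεw K₀ hK₀ => ?_⟩
  obtain ⟨η₂, hη₂, R₂, hR₂, h2⟩ := hT δ hδ a ha Cg hCg K₀ hK₀
  obtain ⟨η₃, hη₃, R₃, hR₃, h3⟩ := hW δ hδ a ha Cg hCg K₀ hK₀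
  refine ⟨min η₂ η₃, lt_min hη₂ hη₃, max R₂ R₃, lt_max_of_lt_left hR₂, ?_⟩
  intro S hS hgood η hη hηle R hR L w hLw Ψ hΨ hBI hfat
  have hR2 : R₂ ≤ R := (le_max_left _ _).trans hR
  have hR3 : R₃ ≤ R := (le_max_right _ _).trans hR
  have htame := h2 S hS hgood η hη (hηle.trans (min_le_left _ _)) R hR2 L w hLw Ψ hΨ hBI hfat
  have hcoh := h3 S hS hgood η hη (hηle.trans (min_le_right _ _)) R hR3 L w hLw Ψ hΨ hBI hfat htame
  have hsub : atomsIn (μS S) 0 R ⊆ atomsIn (μS S) 0 (9 * R) := atomsIn_mono_radius (by linarith [hR₂.le.trans hR2])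
  refine ⟨Ψ, hΨ, ?_⟩
  rw [wildMass_eq_zero_of_isCoherentBy hcoh hsub (fun _ hx => (mem_atomsIn_iff.1 hx).1) hside]
  exact mul_nonneg (mul_nonneg hεw.le hη.le) (nK_nonneg _)

/-- ★★ **(R_Wᵇ) ⟸ [Tᵇ] ∧ [W_Ψᵇ]** — [W_Ψᵇ] instantiated at the SINGLE coarse tolerance `(1/100, 1/200)` (`4/200 + 1/100 = 3/100 < 1/20`); no [SBᵇ].
[critic g24 row 1160 `wildFractionBPG_of_tame_coherent`; this file, g60] -/
theorem wildFractionBPG_of_tame_coherent {ϑ aHi Λ θ s : ℝ} (hT : TameWindowBPG ϑ aHi Λ θ s) (hW : CoherentWindowPsiBPG ϑ aHi Λ θ s) :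
    WildFractionBPG aHi Λ θ s :=
  wildFractionBPG_of_tame_coherent₁ (ϑ₁ := 1 / 100) (ω₁ := 1 / 200) (by norm_num [tameRadius]) hT
    (coherentWindowPsiBPG₁_of hW (by norm_num) (by norm_num))

/-- (R_Wᵇ) from [I_D] ∧ [T_bᵇ] ∧ [W_Ψᵇ₁] under the side condition (part UK `tameWindowBPG_of_dressedCore_of_bare`). [this file, g60] -/
theorem wildFractionBPG_of_dressedCore_coherent₁ {ϑ₁ ω₁ ϑ ϑe ωe : ℝ} {p : ℕ} {r₀ ℓ : ℝ} {M : ℕ} {aHi Λ θ s : ℝ} (hside : 4 * ω₁ + ϑ₁ < tameRadius)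
    (hI : DressedCorePG ϑ ϑe ωe p r₀ ℓ M aHi Λ θ s) (hTb : BareTameWindowBPG ϑ ϑe ωe p r₀ ℓ M aHi Λ θ s)
    (hW : CoherentWindowPsiBPG₁ ϑ₁ ω₁ ϑ aHi Λ θ s) : WildFractionBPG aHi Λ θ s :=
  wildFractionBPG_of_tame_coherent₁ hside (tameWindowBPG_of_dressedCore_of_bare hI hTb) hW

/-- (R_Wᵇ) from [I_D] ∧ [T_bᵇ] ∧ [W_Ψᵇ]. [critic g24 row 1160 `wildFractionBPG_of_dressedCore_coherent`; this file, g60] -/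
theorem wildFractionBPG_of_dressedCore_coherent {ϑ ϑe ωe : ℝ} {p : ℕ} {r₀ ℓ : ℝ} {M : ℕ} {aHi Λ θ s : ℝ}
    (hI : DressedCorePG ϑ ϑe ωe p r₀ ℓ M aHi Λ θ s) (hTb : BareTameWindowBPG ϑ ϑe ωe p r₀ ℓ M aHi Λ θ s)
    (hW : CoherentWindowPsiBPG ϑ aHi Λ θ s) : WildFractionBPG aHi Λ θ s :=
  wildFractionBPG_of_tame_coherent (tameWindowBPG_of_dressedCore_of_bare hI hTb) hW

/-! ### YB.4  The columns of record `_16XH21B`, `_16XH21B₁` -/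

/-- ★★★ **COLUMN OF RECORD `_16XH21B`** (CRITIC-LEDGER row 1160) — part UI's `_16XH18B_tol` at `ν := 1/2000` with (Υb) discharged (`untwistBookkeepingP_one`)
and (R_Wᵇ) cut by [I_D] ∧ [T_bᵇ] ∧ [W_Ψᵇ] ALONE (`wildFractionBPG_of_dressedCore_coherent`): part XY's `_16XH20B` with the SB-glue, (RC) `EquilChartStrainP`
and (I4ˢ) `TailFluxBSP` DELETED.  Binders: the twenty generic leaves of `_16XH18B_tol`, then [I_D], [T_bᵇ], [W_Ψᵇ], and the crystal import
`PeriodicBulkGapDoor 2`. [this file, g60] -/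
theorem gap_and_pert_1_50_of_certs_16XH21B (hL : LatticeLiouvilleCert) (hL' : LayeredLiouvilleCert)
    (hR : OscRigidityL2BDPG 1 2 (1 / 16) (1 / 16)) (hX : ExcessFlatnessControlP 1 2 (1 / 16) (1 / 16))
    (hE : ExcessChartLocalisationP 1 2 (1 / 16) (1 / 100)) (hP : RegistrationP 1 2 (1 / 16) (1 / 100))
    (hT : TailDominationCert) (hU : UniformTameStabilityE (1 / 50) 2 (1 / 2000))
    (h1 : WordTransplantP 1 2 (1 / 16) (1 / 100)) (hGT : GradReframingThickP 1 2 (1 / 16) (1 / 100) (1 / 50))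
    (hΛ0 : LaunderingAprioriPX 1 2 (1 / 16) (1 / 100) (1 / 50)) (hΛs : LaunderingStepPX 1 2 (1 / 16) (1 / 100) (1 / 50))
    (hUc : UntwistCollarP 1 2 (1 / 16) (1 / 50))
    (hl : BondIsoLevelsP 1 2 (1 / 16) (1 / 50)) (hN : EnergyNearChartPX 1 2 (1 / 16) (1 / 50) (1 / 2000))
    (hF : TailForceSlavingP 1 2 (1 / 16) (1 / 50))
    (hE' : LipDualLinearisationP 1 2 (1 / 16) (1 / 50)) (hA : L2HarmonicApproxPE 1 2 (1 / 16) (1 / 50) (1 / 2000))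
    (hD : PositionDecayPLE 1 2 (1 / 16) (1 / 50) (1 / 2000)) (hC : PositionCaccioppoliPGE 1 2 (1 / 16) (1 / 50) (1 / 2000))
    (hI : DressedCorePG tameRadius dressLevel dressLevel dressExponent 8 collarRadius clusterSize 1 2 (1 / 16) (1 / 50))
    (hTb : BareTameWindowBPG tameRadius dressLevel dressLevel dressExponent 8 collarRadius clusterSize 1 2 (1 / 16) (1 / 50))
    (hWΨ : CoherentWindowPsiBPG tameRadius 1 2 (1 / 16) (1 / 50))
    (hG : PeriodicBulkGapDoor 2) : VisibleGap (1 / 50) ∧ PertRegime (1 / 50) :=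
  gap_and_pert_1_50_of_certs_16XH18B_tol hL hL' hR hX hE hP hT hU h1 hGT hΛ0 hΛs hUc (untwistBookkeepingP_one 2 (1 / 50)) hl hN hF hE' hA hD hC
    (wildFractionBPG_of_dressedCore_coherent hI hTb hWΨ) hG

/-- ★★★ **COLUMN `_16XH21B₁`** — `_16XH21B` with [W_Ψᵇ] WEAKENED to the single-tolerance leaf [W_Ψᵇ₁] at the default pair `(1/100, 1/200)`
(`wildFractionBPG_of_dressedCore_coherent₁`, side condition `4/200 + 1/100 < 1/20` by `norm_num`).  RESIDUAL DOCKET OF RECORD for `stmt-26636`: the twenty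
generic leaves + {[I_D], [T_bᵇ], [W_Ψᵇ₁]} + `PeriodicBulkGapDoor 2`. [this file, g60] -/
theorem gap_and_pert_1_50_of_certs_16XH21B₁ (hL : LatticeLiouvilleCert) (hL' : LayeredLiouvilleCert)
    (hR : OscRigidityL2BDPG 1 2 (1 / 16) (1 / 16)) (hX : ExcessFlatnessControlP 1 2 (1 / 16) (1 / 16))
    (hE : ExcessChartLocalisationP 1 2 (1 / 16) (1 / 100)) (hP : RegistrationP 1 2 (1 / 16) (1 / 100))
    (hT : TailDominationCert) (hU : UniformTameStabilityE (1 / 50) 2 (1 / 2000))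
    (h1 : WordTransplantP 1 2 (1 / 16) (1 / 100)) (hGT : GradReframingThickP 1 2 (1 / 16) (1 / 100) (1 / 50))
    (hΛ0 : LaunderingAprioriPX 1 2 (1 / 16) (1 / 100) (1 / 50)) (hΛs : LaunderingStepPX 1 2 (1 / 16) (1 / 100) (1 / 50))
    (hUc : UntwistCollarP 1 2 (1 / 16) (1 / 50))
    (hl : BondIsoLevelsP 1 2 (1 / 16) (1 / 50)) (hN : EnergyNearChartPX 1 2 (1 / 16) (1 / 50) (1 / 2000))
    (hF : TailForceSlavingP 1 2 (1 / 16) (1 / 50))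
    (hE' : LipDualLinearisationP 1 2 (1 / 16) (1 / 50)) (hA : L2HarmonicApproxPE 1 2 (1 / 16) (1 / 50) (1 / 2000))
    (hD : PositionDecayPLE 1 2 (1 / 16) (1 / 50) (1 / 2000)) (hC : PositionCaccioppoliPGE 1 2 (1 / 16) (1 / 50) (1 / 2000))
    (hI : DressedCorePG tameRadius dressLevel dressLevel dressExponent 8 collarRadius clusterSize 1 2 (1 / 16) (1 / 50))
    (hTb : BareTameWindowBPG tameRadius dressLevel dressLevel dressExponent 8 collarRadius clusterSize 1 2 (1 / 16) (1 / 50))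
    (hWΨ₁ : CoherentWindowPsiBPG₁ (1 / 100) (1 / 200) tameRadius 1 2 (1 / 16) (1 / 50))
    (hG : PeriodicBulkGapDoor 2) : VisibleGap (1 / 50) ∧ PertRegime (1 / 50) :=
  gap_and_pert_1_50_of_certs_16XH18B_tol hL hL' hR hX hE hP hT hU h1 hGT hΛ0 hΛs hUc (untwistBookkeepingP_one 2 (1 / 50)) hl hN hF hE' hA hD hC
    (wildFractionBPG_of_dressedCore_coherent₁ (by norm_num [tameRadius]) hI hTb hWΨ₁) hG

/-- Record: the weakest-misfit admissible pair `(1/24, 1/500)` (`4/500 + 1/24 < 1/20`) also cuts (R_Wᵇ). [this file, g60] -/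
example {ϑ ϑe ωe : ℝ} {p : ℕ} {r₀ ℓ : ℝ} {M : ℕ} {aHi Λ θ s : ℝ}
    (hI : DressedCorePG ϑ ϑe ωe p r₀ ℓ M aHi Λ θ s) (hTb : BareTameWindowBPG ϑ ϑe ωe p r₀ ℓ M aHi Λ θ s)
    (hW : CoherentWindowPsiBPG₁ (1 / 24) (1 / 500) ϑ aHi Λ θ s) : WildFractionBPG aHi Λ θ s :=
  wildFractionBPG_of_dressedCore_coherent₁ (by norm_num [tameRadius]) hI hTb hW

end Summit.AtomisticToContinuum.Crystallization.Theorems.ChartedZeroExcessLayeredLatticeLiouville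

end
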